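import Mathlib
import Summits.Ventures.HodgeRepro2.Tier7.Line3.CompactPlaceFactor
import Summits.Ventures.HodgeRepro2.Tier7.Line3.LocalFactorClauses
import Summits.Ventures.HodgeRepro2.Tier7.Line3.ConcreteLevelFactor
import Summits.Ventures.HodgeRepro2.Tier7.Line3.AdicCompletionInvolution

/-!
# Tier7/Line3/CompactPlaceCompletion — the `S`-places' kind on the concrete tori and on Mathlib's completion
(seat t7-L1-p2, gen 8; the twin of UnramifiedPlaceCompletion p718753 for CompactPlaceFactor p709575; plan-3's
line-level read STATUS l. 16380 and crit-2's statement-level read l. 16384, both inside the window of TARGET l. 16379)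

LINE 3 (t7-plan-3), version (ii). CompactPlaceFactor (p709575) proves the three per-place clauses at a place of `S`
for an ABSTRACT finite open-positive measure on an abstract compact torus `T`: `‖b γ‖ ≤ vol` for every `γ` and
`b γ₀ ≠ 0` when the integrand at `γ₀` is the indicator of a non-empty open set (p1's positivity row
T7SupportLocalFactorPositive p664522). This module instantiates it on the MODEL's tori, as UnramifiedPlaceCompletion
instantiated the unramified kind:

* `orbitMap σ f loc γ : torusA σ × torusB σ f → GL (Fin 2) F`, `(t, t′) ↦ ι_A(t)⁻¹ · loc γ · ι_B(t′)` — the model's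
  orbit map on the concrete tori of TorusSupport (p695064) / TorusCompact (p697465) (the `act` of
  CompactTorusFactorBound p678241); CONTINUOUS (`continuous_orbitMap`: `continuous_iotaA / continuous_iotaB` of
  ConcreteLevelFactor p698828 and the topological-group structure of `GL (Fin 2) F`, LevelTowerTopology p696895);
* `integrable_orbital_of_isOpen`: for an OPEN support `W` and a CONTINUOUS unitary `χ`, the orbital integrand
  `t ↦ 1_W(orbitMap γ t) · χ t` is Borel-measurable and bounded by `1`, hence INTEGRABLE for every finite Borel
  measure — the Bochner integral `compactFactor` is the honest integral, never the junk value `0` (crit-2 l. 16384 (1),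
  plan-3 l. 16380 (2));
* `compactFactor_γ₀_eq` / `compactFactor_γ₀_norm_eq` / `measureReal_pos_of_isOpen`: the value at `γ₀` IS the
  volume of `U` (`b γ₀ = μ.real U`, `‖b γ₀‖ = μ.real U`), and `0 < μ.real U` for an open-positive finite `μ` — so the
  ratio constant `C = μ.real univ / ‖b γ₀‖ = μ.real univ / μ.real U` is a NUMBER (never a quotient by `0`);
* `compact_placeClauses`: on a proper normed field `F` with a continuous isometric involution `σ` and the second
  basis `f` (matrix `P`), for an OPEN support `W ⊆ GL₂(F)` (the real `K_w` / level set is open-closed — `W` is FIXED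
  at an `S`-place, independent of the level `N`, which is why the constant `C` is one constant for all `N` at this
  kind), a CONTINUOUS unitary `χ` on `T_A × T_B` (the real characters are locally constant), a local component `loc`
  and the DISPLAYED `hγ₀` («the integrand at `γ₀` is the indicator of a non-empty open `U ⊆ T_A × T_B`», pointwise
  and measure-free — it packs TWO facts about the real data: `{t | orbitMap γ₀ t ∈ W} = U` and `χ ≡ 1` on `U`, the
  latter the conductor / «characters trivial on a small open piece of the orbit of `γ₀`» condition of memo §2c; a
  DATUM of the real characters, not a theorem here — no instance of the real characters is exhibited), the
  conclusion for Mathlib's Haar measure on the COMPACT product group `T_A × T_B`: the Borel σ-algebra and the Haar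
  measure DISPLAYED as conjuncts of an `∃` (the ConcreteLevelFactor p698828 form; the witness is Mathlib's
  `Measure.haar`, not «some measure making the clauses true»), every orbital integrand INTEGRABLE, `‖b γ₀‖ = μ.real U`,
  `0 < μ.real U`, and LocalFactorClauses' (p717818) `PlaceClauses` with `arith := fun _ => True`,
  `C := μ.real Set.univ / ‖b γ₀‖`, `ε = 0`, through `CompactPlaceFactor.compactFactor_clauses` by name;
* `orbital_univ_one`: NON-VACUITY — the hypotheses are satisfiable (`W = univ`, `χ ≡ 1`, `U = univ` give `hγ₀`);
* `compact_placeClauses_adicCompletion`: the same at `F := w.adicCompletion E`, `σ := completionMap w σ hσ` (the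
  instance binders `ProperSpace`, `IsUltrametricDist` and `hσc / hσn` discharged by AdicCompletionLocalField p703140 /
  AdicCompletionInvolution p703979, exactly as p718753).

INSTANCES CONSUMED (for the pre-read): `compactSpace_torusA σ hσc hσn`, `compactSpace_torusB σ f P hσc hσn hP`
(TorusCompact p697465), `secondCountable_torusA σ`, `secondCountable_torusB σ f` (ConcreteLevelFactor p698828), the
subgroup / product group and topological-group instances of Mathlib on `torusA σ × torusB σ f` (`torusA σ ≤ Fin 2 → Fˣ`,
`torusB σ f ≤ GL (Fin 2) F`, TorusSupport p695064), `LocallyCompactSpace` from `CompactSpace`, `T2Space` from the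
ambient groups, `borel` + `BorelSpace ⟨rfl⟩`, `Measure.haar` with its `IsHaarMeasure` instance (hence
`IsOpenPosMeasure`), `CompactSpace.isFiniteMeasure`.

WHAT THIS CHANGES IN THE [W] COLUMN: at the compact places `w ∈ S` the kind clauses of the per-place predicate — the
bound `|b_w(γ)| ≤ vol` from unitarity and the value `b_w(γ₀) = vol(U) ≠ 0` — are THEOREMS of Mathlib's Haar measure on
the concrete compact tori at `w.adicCompletion E`, with ONLY `W` (open), the unitary continuous `χ`, `loc` and the
displayed `hγ₀` (the local (C)-type condition at `w ∈ S`) as data. STILL IN WORDS: which `W` (`K_w` / the level set),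
that `χ = μ_{A,w} ⊗ μ_{B,w}⁻¹`, that `hγ₀` holds for the real characters, the identification (a′). Nothing here is
about (N), (P), the real `X`, or HC_CM; §8(d): NO. Blind lane: Mathlib + the HodgeRepro2 prefix; no sorry;
axioms ⊆ {propext, Classical.choice, Quot.sound}.
-/

namespace Summit.Ventures.HodgeRepro2.Tier7.Line3.CompactPlaceCompletion

open MeasureTheory NumberField IsDedekindDomain IsDedekindDomain.HeightOneSpectrum
  Summit.Ventures.HodgeRepro2.Tier7.Line3.TorusSupport
  Summit.Ventures.HodgeRepro2.Tier7.Line3.TorusCompact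
  Summit.Ventures.HodgeRepro2.Tier7.Line3.ConcreteLevelFactor
  Summit.Ventures.HodgeRepro2.Tier7.Line3.CompactTorusFactorBound
  Summit.Ventures.HodgeRepro2.Tier7.Line3.CompactPlaceFactor
  Summit.Ventures.HodgeRepro2.Tier7.Line3.LocalFactorClauses
  Summit.Ventures.HodgeRepro2.Tier7.Line3.AdicCompletionInvolution
open scoped NumberField

/-! ## The orbit map on the concrete tori -/

section orbit

variable {F : Type*} [Field F] (σ : F →+* F) (f : Fin 2 → Fin 2 → F)

/-- **the model's orbit map** on the concrete tori: `(t, t′) ↦ ι_A(t)⁻¹ · loc γ · ι_B(t′)` — CompactTorusFactorBound's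
`act γ` with `T := T_A × T_B` and the local component `loc γ` of the double coset. -/
def orbitMap {Orb : Type*} (loc : Orb → GL (Fin 2) F) (γ : Orb) (t : torusA σ × torusB σ f) : GL (Fin 2) F :=
  (iotaA σ t.1)⁻¹ * loc γ * iotaB σ f t.2

/-- the orbit map, by definition. -/
theorem orbitMap_apply {Orb : Type*} (loc : Orb → GL (Fin 2) F) (γ : Orb) (t : torusA σ × torusB σ f) :
    orbitMap σ f loc γ t = (iotaA σ t.1)⁻¹ * loc γ * iotaB σ f t.2 := rfl

/-- **NON-VACUITY of the positivity datum**: with `W = univ`, `χ ≡ 1` and `U = univ` the hypothesis `hγ₀` of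
`compact_placeClauses` holds (p1's positivity shape is satisfiable). -/
theorem orbital_univ_one {Orb : Type*} (loc : Orb → GL (Fin 2) F) (γ₀ : Orb) (t : torusA σ × torusB σ f) :
    orbital (Set.univ : Set (GL (Fin 2) F)) (orbitMap σ f loc γ₀) (fun _ => (1 : ℂ)) t =
      (Set.univ : Set (torusA σ × torusB σ f)).indicator (fun _ => (1 : ℂ)) t := by
  simp [orbital]

end orbit

/-! ## Continuity of the orbit map, integrability of the orbital integrand -/

section continuity

variable {F : Type*} [NormedField F] (σ : F →+* F) (f : Fin 2 → Fin 2 → F)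

/-- **the orbit map is continuous** (`continuous_iotaA / continuous_iotaB` and the topological group `GL (Fin 2) F`). -/
theorem continuous_orbitMap {Orb : Type*} (loc : Orb → GL (Fin 2) F) (γ : Orb) :
    Continuous (orbitMap σ f loc γ) :=
  ((((continuous_iotaA σ).comp continuous_fst).inv).mul continuous_const).mul
    ((continuous_iotaB σ f).comp continuous_snd)

/-- **the orbital integrand is Borel-measurable** for an OPEN support `W` and a CONTINUOUS `χ`: the indicator of the
open preimage `orbitMap γ ⁻¹' W` times the continuous `χ`. -/
theorem measurable_orbital_of_isOpen [MeasurableSpace (torusA σ × torusB σ f)]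
    [OpensMeasurableSpace (torusA σ × torusB σ f)] (W : Set (GL (Fin 2) F)) (hW : IsOpen W)
    (χ : torusA σ × torusB σ f → ℂ) (hχc : Continuous χ) {Orb : Type*} (loc : Orb → GL (Fin 2) F) (γ : Orb) :
    Measurable (fun t => orbital W (orbitMap σ f loc γ) χ t) := by
  have h1 : (fun t => W.indicator (fun _ => (1 : ℂ)) (orbitMap σ f loc γ t)) =
      (orbitMap σ f loc γ ⁻¹' W).indicator (fun _ => (1 : ℂ)) := by
    funext t
    exact (Set.indicator_comp_right (s := W) (orbitMap σ f loc γ) (g := fun _ => (1 : ℂ))).symm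
  have h2 : Measurable (fun t => W.indicator (fun _ => (1 : ℂ)) (orbitMap σ f loc γ t)) := by
    rw [h1]
    exact measurable_const.indicator ((continuous_orbitMap σ f loc γ).isOpen_preimage W hW).measurableSet
  exact h2.mul hχc.measurable

/-- **the orbital integrand is INTEGRABLE** for every finite Borel measure, an open support and a continuous unitary
`χ` — so `compactFactor` is the honest Bochner integral (no junk value). -/
theorem integrable_orbital_of_isOpen [MeasurableSpace (torusA σ × torusB σ f)]
    [OpensMeasurableSpace (torusA σ × torusB σ f)] (μ : Measure (torusA σ × torusB σ f)) [IsFiniteMeasure μ]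
    (W : Set (GL (Fin 2) F)) (hW : IsOpen W) (χ : torusA σ × torusB σ f → ℂ) (hχc : Continuous χ)
    (hχ : ∀ t, ‖χ t‖ = 1) {Orb : Type*} (loc : Orb → GL (Fin 2) F) (γ : Orb) :
    Integrable (fun t => orbital W (orbitMap σ f loc γ) χ t) μ :=
  Integrable.of_bound (measurable_orbital_of_isOpen σ f W hW χ hχc loc γ).aestronglyMeasurable 1
    (Filter.Eventually.of_forall (norm_orbital_le_one W (orbitMap σ f loc γ) χ hχ))

end continuity

/-! ## The value at `γ₀` -/

section value

variable {F : Type*} [NormedField F] (σ : F →+* F) (f : Fin 2 → Fin 2 → F)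

/-- **the value at `γ₀` is the volume of `U`**: when the integrand at `γ₀` is the indicator of an open set `U`,
`compactFactor μ W (orbitMap σ f loc) χ γ₀ = μ.real U` (any Borel measure `μ`, any `W`, `χ`, `loc`; the integral of
the indicator of the measurable set `U`, `integral_indicator_const`). -/
theorem compactFactor_γ₀_eq [MeasurableSpace (torusA σ × torusB σ f)]
    [OpensMeasurableSpace (torusA σ × torusB σ f)] (μ : Measure (torusA σ × torusB σ f))
    (W : Set (GL (Fin 2) F)) (χ : torusA σ × torusB σ f → ℂ) {Orb : Type*} (loc : Orb → GL (Fin 2) F) (γ₀ : Orb)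
    (U : Set (torusA σ × torusB σ f)) (hU : IsOpen U)
    (hγ₀ : ∀ t, orbital W (orbitMap σ f loc γ₀) χ t = U.indicator (fun _ => (1 : ℂ)) t) :
    compactFactor μ W (orbitMap σ f loc) χ γ₀ = (μ.real U : ℂ) := by
  unfold compactFactor
  have h : (fun t => orbital W (orbitMap σ f loc γ₀) χ t) = U.indicator (fun _ => (1 : ℂ)) := funext hγ₀
  rw [h, integral_indicator_const (1 : ℂ) hU.measurableSet, Complex.real_smul, mul_one]

/-- **the norm of the value at `γ₀` is the volume of `U`** (`μ.real U ≥ 0`). -/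
theorem compactFactor_γ₀_norm_eq [MeasurableSpace (torusA σ × torusB σ f)]
    [OpensMeasurableSpace (torusA σ × torusB σ f)] (μ : Measure (torusA σ × torusB σ f))
    (W : Set (GL (Fin 2) F)) (χ : torusA σ × torusB σ f → ℂ) {Orb : Type*} (loc : Orb → GL (Fin 2) F) (γ₀ : Orb)
    (U : Set (torusA σ × torusB σ f)) (hU : IsOpen U)
    (hγ₀ : ∀ t, orbital W (orbitMap σ f loc γ₀) χ t = U.indicator (fun _ => (1 : ℂ)) t) :
    ‖compactFactor μ W (orbitMap σ f loc) χ γ₀‖ = μ.real U := by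
  rw [compactFactor_γ₀_eq σ f μ W χ loc γ₀ U hU hγ₀, Complex.norm_real, Real.norm_of_nonneg measureReal_nonneg]

end value

/-- **a non-empty open set has positive finite volume** for an open-positive finite measure (`IsOpen.measure_pos`,
`ENNReal.toReal_pos`). -/
theorem measureReal_pos_of_isOpen {T : Type*} [MeasurableSpace T] [TopologicalSpace T] (μ : Measure T)
    [μ.IsOpenPosMeasure] [IsFiniteMeasure μ] (U : Set T) (hU : IsOpen U) (hne : U.Nonempty) : 0 < μ.real U := by
  rw [measureReal_def]
  exact ENNReal.toReal_pos (hU.measure_pos μ hne).ne' (measure_ne_top μ U)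

/-! ## The compact clauses on the concrete tori with Mathlib's Haar measure -/

section concrete

variable {F : Type*} [NormedField F] [ProperSpace F] (σ : F →+* F)

/-- **the three clauses of the compact kind on the concrete model**: the Borel σ-algebra and Mathlib's Haar measure
on the compact product group `T_A × T_B` DISPLAYED as conjuncts (`BorelSpace`, `IsHaarMeasure`); the tori compact by
`compactSpace_torusA / compactSpace_torusB` (TorusCompact), second countable by `secondCountable_torusA / _torusB`
(ConcreteLevelFactor); the OPEN support `W` (fixed at an `S`-place, level-independent), the CONTINUOUS unitary `χ`,
the local component `loc` and `hγ₀` («the integrand at `γ₀` is the indicator of the non-empty open `U`» — p1's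
positivity shape, pointwise; a DATUM of the real characters) displayed. CONCLUSION: every orbital integrand is
integrable (no junk value: `integrable_orbital_of_isOpen`), `‖b γ₀‖ = μ.real U` and `0 < μ.real U`
(`compactFactor_γ₀_norm_eq`, `measureReal_pos_of_isOpen` — the ratio constant is the NUMBER
`μ.real univ / μ.real U`), and `PlaceClauses` through `compactFactor_clauses` by name: support vacuous
(`arith := fun _ => True` — the bound holds on all of `Orb`), `‖b γ‖ ≤ (vol / ‖b γ₀‖) · (1 + size γ)^0 · ‖b γ₀‖`
(= `‖b γ‖ ≤ vol`, `norm_orbital_le_volume`), `b γ₀ ≠ 0` (the Haar measure is open-positive, `U` open and non-empty).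
The clause is independent of `size` (exponent `0`). -/
theorem compact_placeClauses (hσc : Continuous σ) (hσn : ∀ x, ‖σ x‖ = ‖x‖) (f : Fin 2 → Fin 2 → F)
    (P : GL (Fin 2) F) (hP : ∀ j, (P : Matrix (Fin 2) (Fin 2) F).col j = f j)
    (W : Set (GL (Fin 2) F)) (hW : IsOpen W) (χ : torusA σ × torusB σ f → ℂ) (hχc : Continuous χ)
    (hχ : ∀ t, ‖χ t‖ = 1) {Orb : Type*} (loc : Orb → GL (Fin 2) F) (γ₀ : Orb)
    (U : Set (torusA σ × torusB σ f)) (hU : IsOpen U) (hne : U.Nonempty)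
    (hγ₀ : ∀ t, orbital W (orbitMap σ f loc γ₀) χ t = U.indicator (fun _ => (1 : ℂ)) t)
    (size : Orb → ℝ) (hsize : ∀ γ, 0 ≤ size γ) :
    ∃ (m : MeasurableSpace (torusA σ × torusB σ f)) (μ : Measure (torusA σ × torusB σ f)),
      (@BorelSpace (torusA σ × torusB σ f) _ m) ∧ μ.IsHaarMeasure ∧
      (∀ γ, Integrable (fun t => orbital W (orbitMap σ f loc γ) χ t) μ) ∧
      ‖compactFactor μ W (orbitMap σ f loc) χ γ₀‖ = μ.real U ∧ 0 < μ.real U ∧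
      PlaceClauses (compactFactor μ W (orbitMap σ f loc) χ) (fun _ => True)
        (μ.real Set.univ / ‖compactFactor μ W (orbitMap σ f loc) χ γ₀‖) 0 size γ₀ := by
  haveI hcA : CompactSpace (torusA σ) := compactSpace_torusA σ hσc hσn
  haveI hcB : CompactSpace (torusB σ f) := compactSpace_torusB σ f P hσc hσn hP
  haveI hsA : SecondCountableTopology (torusA σ) := secondCountable_torusA σ
  haveI hsB : SecondCountableTopology (torusB σ f) := secondCountable_torusB σ f
  letI m : MeasurableSpace (torusA σ × torusB σ f) := borel _
  haveI hb : BorelSpace (torusA σ × torusB σ f) := ⟨rfl⟩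
  let μ : Measure (torusA σ × torusB σ f) := Measure.haar
  haveI : IsFiniteMeasure μ := CompactSpace.isFiniteMeasure
  refine ⟨m, μ, hb, inferInstance, fun γ => integrable_orbital_of_isOpen σ f μ W hW χ hχc hχ loc γ,
    compactFactor_γ₀_norm_eq σ f μ W χ loc γ₀ U hU hγ₀, measureReal_pos_of_isOpen μ U hU hne, ?_⟩
  have hfin : μ U ≠ ⊤ := measure_ne_top μ U
  have hγ₀' : ∫ t, orbital W (orbitMap σ f loc γ₀) χ t ∂μ = ∫ t, U.indicator (fun _ => (1 : ℂ)) t ∂μ := by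
    have h : (fun t => orbital W (orbitMap σ f loc γ₀) χ t) = U.indicator (fun _ => (1 : ℂ)) := funext hγ₀
    rw [h]
  exact compactFactor_clauses μ W (orbitMap σ f loc) χ hχ γ₀ U hU hne hfin hγ₀' size hsize le_rfl

end concrete

/-! ## At Mathlib's completion -/

section completion

variable {E : Type*} [Field E] [NumberField E] (w : HeightOneSpectrum (𝓞 E)) (σ : E →+* E)
  (hσ : ∀ x, w.valuation E (σ x) = w.valuation E x)

/-- **the compact clauses at `F := w.adicCompletion E`** with `σ := completionMap w σ hσ`: the instance binders
(`ProperSpace`, `IsUltrametricDist`) and `hσc / hσn` discharged (p703140 / p703979) — nothing new displayed. -/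
theorem compact_placeClauses_adicCompletion
    (f : Fin 2 → Fin 2 → w.adicCompletion E) (P : GL (Fin 2) (w.adicCompletion E))
    (hP : ∀ j, (P : Matrix (Fin 2) (Fin 2) (w.adicCompletion E)).col j = f j)
    (W : Set (GL (Fin 2) (w.adicCompletion E))) (hW : IsOpen W)
    (χ : torusA (completionMap w σ hσ) × torusB (completionMap w σ hσ) f → ℂ) (hχc : Continuous χ)
    (hχ : ∀ t, ‖χ t‖ = 1)
    {Orb : Type*} (loc : Orb → GL (Fin 2) (w.adicCompletion E)) (γ₀ : Orb)
    (U : Set (torusA (completionMap w σ hσ) × torusB (completionMap w σ hσ) f)) (hU : IsOpen U)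
    (hne : U.Nonempty)
    (hγ₀ : ∀ t, orbital W (orbitMap (completionMap w σ hσ) f loc γ₀) χ t = U.indicator (fun _ => (1 : ℂ)) t)
    (size : Orb → ℝ) (hsize : ∀ γ, 0 ≤ size γ) :
    ∃ (m : MeasurableSpace (torusA (completionMap w σ hσ) × torusB (completionMap w σ hσ) f))
      (μ : Measure (torusA (completionMap w σ hσ) × torusB (completionMap w σ hσ) f)),
      (@BorelSpace (torusA (completionMap w σ hσ) × torusB (completionMap w σ hσ) f) _ m) ∧ μ.IsHaarMeasure ∧
      (∀ γ, Integrable (fun t => orbital W (orbitMap (completionMap w σ hσ) f loc γ) χ t) μ) ∧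
      ‖compactFactor μ W (orbitMap (completionMap w σ hσ) f loc) χ γ₀‖ = μ.real U ∧ 0 < μ.real U ∧
      PlaceClauses (compactFactor μ W (orbitMap (completionMap w σ hσ) f loc) χ) (fun _ => True)
        (μ.real Set.univ / ‖compactFactor μ W (orbitMap (completionMap w σ hσ) f loc) χ γ₀‖) 0 size γ₀ :=
  compact_placeClauses (completionMap w σ hσ) (continuous_completionMap w σ hσ) (norm_completionMap w σ hσ) f P hP
    W hW χ hχc hχ loc γ₀ U hU hne hγ₀ size hsize

end completion

end Summit.Ventures.HodgeRepro2.Tier7.Line3.CompactPlaceCompletion
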